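import Literature.Analysis.FluidPDE.KNSSTypeII
import HarnessLib

/-!
# No axisymmetric Type I blow-up, boundedness form: the local-to-global glue

Analysis/FluidPDE file, second layer of the decomposition of
`Literature.Analysis.FluidPDE.knss_no_axisymmetric_typeI` (`Axisymmetric.lean`) under
`KNSSTypeII.lean`, whose named target `axisymmetric_typeI_bounded` says: a classical solution of
Navier–Stokes on `ℝ³ × [0, T)` which is Leray–Hopf on `[0, T)`, bounded on `[0, T'] × ℝ³` for
every `T' < T`, axisymmetric, and blowing up at most at the Type I rate at `T`, is bounded on
`[0, T) × ℝ³`. As recorded there, this global statement is reached from three LOCAL inputs with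
distinct sources, through a compactness argument at the final time. This file isolates the three
inputs over a hypothesis structure `AxisymmetricTypeIHyp` (the standing hypotheses of the
target) — the axis input as an explicit hypothesis of the glue, the other two as named
statements — and PROVES the glue
`axisymmetric_typeI_bounded_of_local : near_axis → off_axis → near_infinity →
axisymmetric_typeI_bounded`.

* the axis input (hypothesis `ha` of the glue, not a named statement): every point of the axis
  is, at the final time, a point near which `u` is bounded (`IsBoundedNearTop`) — the global
  reading of Seregin–Šverák 2009, Thm. 3.1 (= Thm. 1.1), which is the catalogued barrier fact
  `Literature.Barriers.NavierStokesRegularity.AxisymmetricTypeIExclusion`; it is PROVED from the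
  barrier in `AxisymmetricTypeIAxis.lean` (`axisymmetric_typeI_boundedNearTop_axis_of_barrier`,
  whose conclusion is literally `ha`) by translation along the axis, parabolic and viscosity
  scaling, with the Riesz (normalised) pressure, whose `L^{3/2}` integrability on bounded
  cylinders follows from the Type I rate, finite energy and the proved `L²` pressure bound
  (`stein1970_normalisedPressure_eLpNorm_le_holds`). (The global reading is not a printed result
  of its own, so under D-0026 it is not vendored as a separate named fact: the former waypoint
  `axisymmetric_typeI_boundedNearTop_axis := ∀ H x₀, cylRadius x₀ = 0 → IsBoundedNearTop u T x₀`
  has been merged into the glue's hypothesis.)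
* `axisymmetric_typeI_boundedNearTop_offAxis` — the same at every point off the axis: the
  classical fact that singular points of axisymmetric suitable weak solutions lie on the axis
  (Caffarelli–Kohn–Nirenberg 1982, Prop. 2 / Theorem B in the backward form of Seregin 2014,
  Ch. 6, Thm. 1.4: `sup_{r<r₀} r⁻¹∫_{Q(z₀,r)}|∇u|² < ε` ⇒ regular), by the rotation count: `N ~ ρ₀/r`
  disjoint rotated cylinders of equal dissipation against `∫_{T−r²}^{T}∫|∇u|² → 0`;
* `typeI_boundedNearTop_infinity` — boundedness on `(T − r², T) × {‖x‖ ≥ R}` for some `R`, `r`: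
  the one-scale ε-regularity criterion (CKN 1982, Prop. 1; Lemarié-Rieusset 2016, Thm. 14.4 =
  accepted fact `lemarieRieusset_epsilon_regularity`) on the tails of `u ∈ L³`, `p_R ∈ L^{3/2}_t L²_x`
  of the slab `(T − r², T) × ℝ³`.

None of the three inputs is a printed theorem as stated (each is a printed local theorem read in
the global setting of the target); the two named ones are tagged folklore and asserted nowhere.
Each named input is IMPLIED by the accepted target (section `Sanity`: `…_of_bounded`), so they do
not enlarge the trust base, and with the glue the target is equivalent to the conjunction of the
three inputs. STATUS: all three are PROVED from printed facts in the next layer (files importing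
this one, so only named here in prose): the axis input from the barrier,
`axisymmetric_typeI_boundedNearTop_axis_of_barrier : AxisymmetricTypeIExclusion →
AxisymmetricTypeIHyp ν T u p → ∀ x₀, cylRadius x₀ = 0 → IsBoundedNearTop u T x₀`
(`AxisymmetricTypeIAxis.lean`), `axisymmetric_typeI_boundedNearTop_offAxis_of_seregin :
seregin2014_thm14 → …_offAxis` (`AxisymmetricTypeIOffAxis.lean`; discharged since,
`axisymmetric_typeI_boundedNearTop_offAxis_holds`, `SereginEpsilonRegularityHolds.lean`),
`typeI_boundedNearTop_infinity_of_LR : lemarieRieusset_epsilon_regularity → …_infinity`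
(`AxisymmetricTypeIInfinity.lean`; discharged since, `typeI_boundedNearTop_infinity_holds`,
`AxisymmetricTypeIInfinityRRS.lean`), over the shared core
`AxisymmetricTypeIData/Gauge/PressureBounds.lean` (suitability below `T` with the gauged Riesz
pressure, `u ∈ L³` and `q ∈ L^{3/2}` of backward cylinders); the assembly
`axisymmetric_typeI_bounded_of_literature : AxisymmetricTypeIExclusion → seregin2014_thm14 →
lemarieRieusset_epsilon_regularity → axisymmetric_typeI_bounded` and
`knss_no_axisymmetric_typeI_of_literature` are in `KNSSNoAxisymmetricTypeI.lean`, so the only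
undischarged input of the target is the barrier. The glue is elementary: a finite subcover of
`closedBall 0 R` by the balls of local boundedness, the minimum of finitely many radii and the
maximum of finitely many bounds, and the sub-slab bound on `[0, T − r₀²/2]`.

## References

* G. Seregin, V. Šverák, Comm. PDE 34 (2009) = arXiv:0804.1803, Thm. 3.1 (= Thm. 1.1).
  [SereginSverak2009]
* L. Caffarelli, R. Kohn, L. Nirenberg, Comm. Pure Appl. Math. 35 (1982), Props. 1–2, Thm. B.
  [CaffarelliKohnNirenberg1982]
* G. Seregin, *Lecture Notes on Regularity Theory for the Navier–Stokes Equations*, World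
  Scientific 2014, Ch. 6, Lemma 6.1 and Thm. 1.4 (PDF pp. 90, 94). [Seregin2014]
* P. G. Lemarié-Rieusset, *The Navier–Stokes Problem in the 21st Century*, CRC 2016, Thm. 14.4
  (p. 505). [LemarieRieusset2016]
* G. Koch, N. Nadirashvili, G. Seregin, V. Šverák, Acta Math. 203 (2009), Thm. 6.2 and the
  remark after it (arXiv p. 12). [KochNadirashviliSereginSverak2009]
-/

noncomputable section

open MeasureTheory Set Function Filter Topology TopologicalSpace Metric
open scoped NNReal ENNReal

namespace Literature.Analysis.FluidPDE

/-- Local notation for physical space `ℝ³ = EuclideanSpace ℝ (Fin 3)`. -/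
local notation "ℝ³" => EuclideanSpace ℝ (Fin 3)

/-! ### The standing hypotheses and local boundedness at the final time -/

/-- **The standing hypotheses of `axisymmetric_typeI_bounded`** (alternative 1 of
`knss_no_axisymmetric_typeI`): `ν > 0`, `T > 0`, `(u, p)` a classical solution of the unforced
Navier–Stokes system on `ℝ³ × [0, T)`, Leray–Hopf on `[0, T)` from `u 0`, bounded on
`[0, T'] × ℝ³` for every `T' < T`, with axisymmetric slices, blowing up at most at the Type I rate
at `T` (KNSS 2009, setting of Thm. 6.2 without its decay hypothesis (assumption2)). A hypothesis
structure in the sense of the conventions; nothing is asserted. [cite: KochNadirashviliSereginSverak2009, Thm 6.2 (setting, arXiv p. 12)] -/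
structure AxisymmetricTypeIHyp (ν T : ℝ) (u : ℝ → ℝ³ → ℝ³) (p : ℝ → ℝ³ → ℝ) : Prop where
  /-- positive viscosity -/
  viscosity_pos : 0 < ν
  /-- positive final time -/
  time_pos : 0 < T
  /-- classical solution on `[0, T)` -/
  classical : IsClassicalNSSolutionOn (Ico 0 T) ν 0 u p
  /-- Leray–Hopf (finite energy) on `[0, T)` -/
  lerayHopf : IsLerayHopfOn T ν 0 (u 0) u
  /-- bounded on every sub-slab `[0, T'] × ℝ³`, `T' < T` -/
  bounded_subslab : ∀ T' < T, ∃ M : ℝ, ∀ t ∈ Icc 0 T', ∀ x, ‖u t x‖ ≤ M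
  /-- axisymmetric slices -/
  axisymmetric : ∀ t ∈ Ico 0 T, IsAxisymmetric (u t)
  /-- at most the Type I rate at `T` -/
  typeI : IsTypeIBlowup u T

/-- **Local boundedness at the final time**: `u` is bounded on a backward parabolic
neighbourhood `(T − r², T) × ball x₀ r` of the space–time point `(T, x₀)`, for some `r > 0` — the
(pointwise, for continuous representatives) content of "`(T, x₀)` is a regular point" with backward
cylinders (Seregin–Šverák 2009, §3: "`v` is regular at `z = 0` if `v` is essentially bounded in
`Q(r)` for some `r > 0`"). Seregin–Šverák's `Q(r) = 𝒞(r) × ]−r², 0[` is built on the solid cylinder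
`𝒞(r) = {|x'| < r, |x₃| < r}` rather than on a ball; under `∃ r > 0` the two shapes are
interchangeable. Compare the essential-boundedness forms `SereginSverak2009.IsRegularAtOrigin`
(`SereginSverakAxisymmetric.lean`, on `Q(r)`), the conclusion
`∃ r > 0, ‖v‖_{L^∞(parabolicCylinder r 0)} < ∞` of the barrier
`Literature.Barriers.NavierStokesRegularity.AxisymmetricTypeIExclusion`, and the accepted
`IsRegularPoint` (`SuitableWeak.lean`, centred cylinders `Q*_r(z)`); for the continuous `u` of
`AxisymmetricTypeIHyp` an essential bound on an open set is an everywhere bound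
(`SereginSverak2009.forall_le_of_ae_le_of_continuousOn`).
[cite: SereginSverak2009, §3 (definition of a regular point, arXiv p. 9)] -/
def IsBoundedNearTop (u : ℝ → ℝ³ → ℝ³) (T : ℝ) (x₀ : ℝ³) : Prop :=
  ∃ r > 0, ∃ K : ℝ, ∀ t ∈ Ioo (T - r ^ 2) T, ∀ x ∈ ball x₀ r, ‖u t x‖ ≤ K

/-- Local boundedness near `(T, x₀)` shrinks to smaller radii. [folklore] -/
theorem IsBoundedNearTop.of_le {u : ℝ → ℝ³ → ℝ³} {T : ℝ} {x₀ : ℝ³} {r r' K : ℝ} (hr' : 0 < r')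
    (hle : r' ≤ r) (h : ∀ t ∈ Ioo (T - r ^ 2) T, ∀ x ∈ ball x₀ r, ‖u t x‖ ≤ K) :
    ∀ t ∈ Ioo (T - r' ^ 2) T, ∀ x ∈ ball x₀ r', ‖u t x‖ ≤ K := by
  intro t ht x hx
  have hsq : r' ^ 2 ≤ r ^ 2 := pow_le_pow_left₀ hr'.le hle 2
  exact h t ⟨by linarith [ht.1], ht.2⟩ x (ball_subset_ball hle hx)

/-! ### The local inputs off the axis and at infinity (named targets of the next layer)

The axis input — under `AxisymmetricTypeIHyp ν T u p`, `u` is bounded near `(T, x₀)` for every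
`x₀` on the axis (`cylRadius x₀ = 0`), the global reading of Seregin–Šverák 2009, Thm. 3.1
(= Thm. 1.1) — is the catalogued barrier fact
`Literature.Barriers.NavierStokesRegularity.AxisymmetricTypeIExclusion` read globally; it enters
the glue `axisymmetric_typeI_bounded_of_local` as the explicit hypothesis `ha` and is proved from
the barrier in `AxisymmetricTypeIAxis.lean` (`axisymmetric_typeI_boundedNearTop_axis_of_barrier`). -/

/-- **Off-axis points are regular** — the classical consequence of the Caffarelli–Kohn–Nirenberg
theory that singular points of axisymmetric suitable weak solutions with finite dissipation lie
on the axis (CKN 1982, Prop. 2 / Thm. B; backward form Seregin 2014, Ch. 6, Thm. 1.4: if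
`sup_{0<r<r₀} r⁻¹ ∫_{Q(z₀, r)} |∇u|² < ε` then `z₀` is regular), by the rotation count against
`∫_{T−r²}^{T} ∫ |∇u|² → 0`: under `AxisymmetricTypeIHyp ν T u p`, `u` is bounded near `(T, x₀)`
for every `x₀` off the axis (`cylRadius x₀ ≠ 0`). The Type I field of the hypothesis structure is
not needed for this input (only axisymmetry, finite dissipation and the classes of the shared
core enter). NOT printed in this form; asserted nowhere; users take
`(h : axisymmetric_typeI_boundedNearTop_offAxis)`. PROVED from the accepted fact
`seregin2014_thm14` (Seregin 2014, Ch. 6, Thm. 1.4) in `AxisymmetricTypeIOffAxis.lean`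
(`axisymmetric_typeI_boundedNearTop_offAxis_of_seregin`). [folklore] -/
def axisymmetric_typeI_boundedNearTop_offAxis : Prop :=
  ∀ ⦃ν T : ℝ⦄ ⦃u : ℝ → ℝ³ → ℝ³⦄ ⦃p : ℝ → ℝ³ → ℝ⦄, AxisymmetricTypeIHyp ν T u p →
    ∀ x₀ : ℝ³, cylRadius x₀ ≠ 0 → IsBoundedNearTop u T x₀

/-- **Boundedness near the final time outside a large ball** — the one-scale ε-regularity
criterion (CKN 1982, Prop. 1; Lemarié-Rieusset 2016, Thm. 14.4 = accepted fact
`lemarieRieusset_epsilon_regularity`, with its uniform bound `C₀ λ / r₀` on `Q_{r₀/2}`) applied on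
the tails of `u ∈ L³`, `p_R ∈ L^{3/2}_t L²_x` of a slab `(T − r², T) × ℝ³` (integrability from
the Type I rate, finite energy and the `L²` pressure bound): under `AxisymmetricTypeIHyp ν T u p`
there are `R`, `r > 0`, `K` with `‖u t x‖ ≤ K` for `T − r² < t < T` and `‖x‖ ≥ R` (axisymmetry
is not needed for this input). NOT printed in this form; asserted nowhere; users take
`(h : typeI_boundedNearTop_infinity)`. PROVED from the accepted fact
`lemarieRieusset_epsilon_regularity` in `AxisymmetricTypeIInfinity.lean`
(`typeI_boundedNearTop_infinity_of_LR`). [folklore] -/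
def typeI_boundedNearTop_infinity : Prop :=
  ∀ ⦃ν T : ℝ⦄ ⦃u : ℝ → ℝ³ → ℝ³⦄ ⦃p : ℝ → ℝ³ → ℝ⦄, AxisymmetricTypeIHyp ν T u p →
    ∃ R r K : ℝ, 0 < r ∧ ∀ t ∈ Ioo (T - r ^ 2) T, ∀ x : ℝ³, R ≤ ‖x‖ → ‖u t x‖ ≤ K

/-! ### Sanity: the named inputs are implied by the target -/

section Sanity

variable {ν T : ℝ} {u : ℝ → ℝ³ → ℝ³} {p : ℝ → ℝ³ → ℝ}

/-- A bound on `[0, T) × ℝ³` gives local boundedness near every point of the final time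
(radius `√T`, so that the backward interval is `(0, T)`). [folklore] -/
theorem isBoundedNearTop_of_bound (hT : 0 < T) {M : ℝ} (hM : ∀ t ∈ Ico 0 T, ∀ x, ‖u t x‖ ≤ M)
    (x₀ : ℝ³) : IsBoundedNearTop u T x₀ := by
  refine ⟨Real.sqrt T, Real.sqrt_pos.2 hT, M, fun t ht x _ => hM t ⟨?_, ht.2⟩ x⟩
  have h := ht.1
  rw [Real.sq_sqrt hT.le, sub_self] at h
  exact h.le

/-- The target `axisymmetric_typeI_bounded` implies the off-axis input (so the latter does not
enlarge the trust base). [folklore] -/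
theorem axisymmetric_typeI_boundedNearTop_offAxis_of_bounded (h : axisymmetric_typeI_bounded) :
    axisymmetric_typeI_boundedNearTop_offAxis := by
  intro ν T u p H x₀ _
  obtain ⟨M, hM⟩ := h H.viscosity_pos H.time_pos H.classical H.lerayHopf H.bounded_subslab
    H.axisymmetric H.typeI
  exact isBoundedNearTop_of_bound H.time_pos hM x₀

/-- The target `axisymmetric_typeI_bounded` implies the input at infinity (`R = 0`, `r = √T`).
[folklore] -/
theorem typeI_boundedNearTop_infinity_of_bounded (h : axisymmetric_typeI_bounded) :
    typeI_boundedNearTop_infinity := by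
  intro ν T u p H
  obtain ⟨M, hM⟩ := h H.viscosity_pos H.time_pos H.classical H.lerayHopf H.bounded_subslab
    H.axisymmetric H.typeI
  refine ⟨0, Real.sqrt T, M, Real.sqrt_pos.2 H.time_pos, fun t ht x _ => hM t ⟨?_, ht.2⟩ x⟩
  have h1 := ht.1
  rw [Real.sq_sqrt H.time_pos.le, sub_self] at h1
  exact h1.le

end Sanity

/-! ### Proved: the compactness glue -/

section Glue

variable {ν T : ℝ} {u : ℝ → ℝ³ → ℝ³} {p : ℝ → ℝ³ → ℝ}

/-- **Local boundedness at every point of the final time plus boundedness near infinity give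
boundedness on a final slab.** If `u` is bounded near `(T, x₀)` for every `x₀ ∈ ℝ³` and bounded
on `(T − r₁², T) × {‖x‖ ≥ R}`, then `u` is bounded on `(T − r₀², T) × ℝ³` for some `r₀ > 0`:
cover the compact `closedBall 0 R` by finitely many balls of local boundedness and take the least
radius and the largest bound. [folklore] -/
theorem exists_bound_final_slab (hloc : ∀ x₀ : ℝ³, IsBoundedNearTop u T x₀) {R r₁ K₁ : ℝ}
    (hr₁ : 0 < r₁) (hfar : ∀ t ∈ Ioo (T - r₁ ^ 2) T, ∀ x : ℝ³, R ≤ ‖x‖ → ‖u t x‖ ≤ K₁) :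
    ∃ r₀ > 0, ∃ K : ℝ, ∀ t ∈ Ioo (T - r₀ ^ 2) T, ∀ x, ‖u t x‖ ≤ K := by
  choose r hr K hK using hloc
  -- finite subcover of the closed ball
  obtain ⟨s, hs⟩ := (isCompact_closedBall (0 : ℝ³) R).elim_finite_subcover
    (fun x₀ => ball x₀ (r x₀)) (fun _ => isOpen_ball)
    (fun x _ => mem_iUnion.2 ⟨x, mem_ball_self (hr x)⟩)
  -- least radius, largest bound
  set radii : Finset ℝ := insert r₁ (s.image r) with hradii
  set bounds : Finset ℝ := insert K₁ (s.image K) with hbounds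
  have hne : radii.Nonempty := Finset.insert_nonempty _ _
  have hneb : bounds.Nonempty := Finset.insert_nonempty _ _
  set r₀ : ℝ := radii.min' hne with hr₀
  set K₀ : ℝ := bounds.max' hneb with hK₀
  have hr₀pos : 0 < r₀ := by
    rw [hr₀, Finset.lt_min'_iff]
    intro y hy
    rw [hradii, Finset.mem_insert, Finset.mem_image] at hy
    rcases hy with rfl | ⟨x₀, -, rfl⟩
    · exact hr₁
    · exact hr x₀
  have hr₀r₁ : r₀ ≤ r₁ := Finset.min'_le _ _ (Finset.mem_insert_self _ _)
  have hr₀r : ∀ x₀ ∈ s, r₀ ≤ r x₀ := fun x₀ hx₀ =>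
    Finset.min'_le _ _ (Finset.mem_insert_of_mem (Finset.mem_image_of_mem r hx₀))
  have hK₁K₀ : K₁ ≤ K₀ := Finset.le_max' _ _ (Finset.mem_insert_self _ _)
  have hKK₀ : ∀ x₀ ∈ s, K x₀ ≤ K₀ := fun x₀ hx₀ =>
    Finset.le_max' _ _ (Finset.mem_insert_of_mem (Finset.mem_image_of_mem K hx₀))
  refine ⟨r₀, hr₀pos, K₀, fun t ht x => ?_⟩
  by_cases hxR : R ≤ ‖x‖
  · have ht₁ : t ∈ Ioo (T - r₁ ^ 2) T :=
      ⟨by nlinarith [ht.1, pow_le_pow_left₀ hr₀pos.le hr₀r₁ 2], ht.2⟩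
    exact (hfar t ht₁ x hxR).trans hK₁K₀
  · have hxball : x ∈ closedBall (0 : ℝ³) R := by
      rw [mem_closedBall, dist_zero_right]
      exact (not_le.1 hxR).le
    obtain ⟨x₀, hx₀s, hxx₀⟩ : ∃ x₀ ∈ s, x ∈ ball x₀ (r x₀) := by
      simpa only [mem_iUnion, exists_prop] using hs hxball
    have htx₀ : t ∈ Ioo (T - r x₀ ^ 2) T :=
      ⟨by nlinarith [ht.1, pow_le_pow_left₀ hr₀pos.le (hr₀r x₀ hx₀s) 2], ht.2⟩
    exact (hK x₀ t htx₀ x hxx₀).trans (hKK₀ x₀ hx₀s)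

/-- A bound on a final slab `(T − r₀², T) × ℝ³` and the sub-slab bounds give a bound on
`[0, T) × ℝ³` (split at `T − r₀²/2`). [folklore] -/
theorem exists_bound_Ico_of_final_slab
    (hbdd : ∀ T' < T, ∃ M : ℝ, ∀ t ∈ Icc 0 T', ∀ x, ‖u t x‖ ≤ M) {r₀ K : ℝ} (hr₀ : 0 < r₀)
    (hK : ∀ t ∈ Ioo (T - r₀ ^ 2) T, ∀ x, ‖u t x‖ ≤ K) :
    ∃ M : ℝ, ∀ t ∈ Ico 0 T, ∀ x, ‖u t x‖ ≤ M := by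
  have hr₀2 : 0 < r₀ ^ 2 := pow_pos hr₀ 2
  obtain ⟨M, hM⟩ := hbdd (T - r₀ ^ 2 / 2) (by linarith)
  refine ⟨max M K, fun t ht x => ?_⟩
  by_cases htT : t ≤ T - r₀ ^ 2 / 2
  · exact (hM t ⟨ht.1, htT⟩ x).trans (le_max_left _ _)
  · exact (hK t ⟨by linarith [not_le.1 htT], ht.2⟩ x).trans (le_max_right _ _)

/-- **The glue: `axisymmetric_typeI_bounded` from its three local inputs.** Under the standing
hypotheses, every point of the final time is a point of local boundedness (axis points by the
hypothesis `ha` — the global reading of Seregin–Šverák 2009, Thm. 3.1, supplied by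
`axisymmetric_typeI_boundedNearTop_axis_of_barrier` in `AxisymmetricTypeIAxis.lean` — the others
by `axisymmetric_typeI_boundedNearTop_offAxis`), `u` is bounded near the final time outside a
large ball (`typeI_boundedNearTop_infinity`), hence on a final slab (`exists_bound_final_slab`,
compactness of `closedBall 0 R`), hence on `[0, T) × ℝ³` with the sub-slab bounds
(`exists_bound_Ico_of_final_slab`). [folklore] -/
theorem axisymmetric_typeI_bounded_of_local
    (ha : ∀ ⦃ν T : ℝ⦄ ⦃u : ℝ → ℝ³ → ℝ³⦄ ⦃p : ℝ → ℝ³ → ℝ⦄, AxisymmetricTypeIHyp ν T u p →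
      ∀ x₀ : ℝ³, cylRadius x₀ = 0 → IsBoundedNearTop u T x₀)
    (hb : axisymmetric_typeI_boundedNearTop_offAxis) (hc : typeI_boundedNearTop_infinity) :
    axisymmetric_typeI_bounded := by
  intro ν T u p hν hT hcl hLH hbdd haxi hI
  have H : AxisymmetricTypeIHyp ν T u p := ⟨hν, hT, hcl, hLH, hbdd, haxi, hI⟩
  have hloc : ∀ x₀ : ℝ³, IsBoundedNearTop u T x₀ := fun x₀ => by
    by_cases h0 : cylRadius x₀ = 0
    · exact ha H x₀ h0
    · exact hb H x₀ h0
  obtain ⟨R, r₁, K₁, hr₁, hfar⟩ := hc H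
  obtain ⟨r₀, hr₀, K, hK⟩ := exists_bound_final_slab hloc hr₁ hfar
  exact exists_bound_Ico_of_final_slab hbdd hr₀ hK

end Glue

end Literature.Analysis.FluidPDE

end
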